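import Literature.NumberTheory.EllipticCurves.Rank1Residual.PPartGoodOrdinarySurj
import Literature.NumberTheory.EllipticCurves.Rank1Residual.Typed.Basic
import HarnessLib

/-!
# FIELD 3 of line `three_field_road` v3 (crux `AdditiveBranchIMC.GordTwoRankZeroOffCaseOne`,
# stmt-BirchSwinnertonDyer-19357, route K1 `AdditiveBranchIMC`): the good-ordinary rank-zero partner's
# `p`-part from Skinner–Urban 2014 Thm. 2 (a), FACTS EXPLICIT — the core of stub `stub_partnerLowerSU`
# (stub-worker `bsd-line-addord-w3` under LEAD `cruxlead-stmt-BirchSwinnertonDyer-19357`; `--supports`)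

HONEST FRAMING. Two glue theorems over tree material; no definition, no named fact, no `sorry`; BSD is
proved for no curve here and the crux item stays OPEN. The registered stub `stub_partnerLowerSU`
(skeleton v3 ec8e676431ae) asks, from the line's cite-only conjunction `PrintedFactsR0`, for the LOWER
half `MissingLowerBoundAt A p` of the partner `A` (analytic rank `0`, `p ≥ 5` good ordinary,
`ρ̄_{A,p}` onto, a multiplicative `ℓ ≠ p` with `p ∤ v_ℓ(Δ_min)`). This file proves that conclusion —
and the whole `p`-part `MissingPPartAt A p` — from the THREE conjuncts of `PrintedFactsR0` it uses,
taken as explicit named-fact hypotheses: bsd.S30 `padicValRat_bsd_rank_zero` (Skinner–Urban 2014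
Thm. 2 (a)), modularity `hasEntireLFunction_rat` (`L(A,1) ≠ 0` in analytic rank `0`) and
Gross–Zagier–Kolyvagin `rank_eq_analyticRank_of_analyticRank_le_one` (`Ш(A)` finite). The by-name
form `stub_partnerLowerSU : PrintedFactsR0 → …` is the sibling file
`AdditiveBranchIMCGordTwoRankZeroOffCaseOnePartnerLowerSU.lean` (one line over this one).

PROOF. `Rank1Residual.bsdp_rankZero_of_S30` (the bsd-percentage cell's bridge: S30's print shape,
torsion term carried, ⟹ Miller's `BSDp A p`), then the typed bookkeeping
`Typed.missingPPartAt_of_bsdp` (`ord_p #Ш(p) = ord_p #Ш` for finite `Ш`) and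
`Typed.lower_and_upper_of_missingPPartAt`.

References (locators only): [cite: SkinnerUrban2014, Thm. 2 (a) (p. 3) = Thm. 3.6.11 (a) (p. 46)]
[cite: Miller2011LMS, Def. 1.1 (arXiv:1010.2431 p. 3)]. presearch: n/a (assembly of tree theorems).
Axioms: `propext`, `Classical.choice`, `Quot.sound`.
-/

set_option autoImplicit false
-- D-0017: single-problem summit, so `Summit.BirchSwinnertonDyer.BirchSwinnertonDyer.…` repeats a namespace BY DESIGN.
set_option linter.dupNamespace false

noncomputable section

open scoped Classical

namespace Summit.BirchSwinnertonDyer.BirchSwinnertonDyer.Theorems.AdditiveBranchIMCThreeFieldRoad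

open WeierstrassCurve Literature.NumberTheory.EllipticCurves
  Literature.NumberTheory.EllipticCurves.Rank1Residual
  Literature.NumberTheory.EllipticCurves.Rank1Residual.Typed

/-- **The partner's `p`-part from Skinner–Urban 2014 Thm. 2 (a), facts explicit.** At a good ordinary
`p ≥ 3` with `ρ̄_{A,p}` onto and a multiplicative `ℓ ≠ p` at which `ρ̄_{A,p}` is ramified
(`p ∤ v_ℓ(Δ_min)`), an elliptic curve `A/ℚ` (globally minimal model) of analytic rank `0` satisfies
`MissingPPartAt A p` (`#Ш_an(A)` is a rational `q` with `ord_p q = ord_p #Ш(A)`): bsd.S30 (`hS30`) +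
modularity (`hmod`) + Gross–Zagier–Kolyvagin (`hGZK`) give `BSDp A p` (`bsdp_rankZero_of_S30`), and
`missingPPartAt_of_bsdp` reads it in Miller's currency (`Ш(A)` finite by `hGZK`).
[cite: SkinnerUrban2014, Thm. 2 (a) (p. 3)] [cite: Miller2011LMS, Def. 1.1] -/
theorem missingPPartAt_rankZero_of_S30 (hS30 : padicValRat_bsd_rank_zero)
    (hmod : hasEntireLFunction_rat) (hGZK : rank_eq_analyticRank_of_analyticRank_le_one)
    (A : WeierstrassCurve ℚ) [A.IsElliptic] [A.IsGloballyMinimal] (p : ℕ) [Fact p.Prime]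
    (hp : 3 ≤ p) (hr : A.analyticRank = 0) (hgo : GoodOrd A p) (hsurj : Surj A p)
    (haux : ∃ ℓ : ℕ, ∃ _ : Fact ℓ.Prime, ℓ ≠ p ∧ A.HasMultiplicativeReductionAtPrime ℓ ∧
      ¬ p ∣ padicValInt ℓ A.minimalDiscriminantInt) :
    MissingPPartAt A p := by
  haveI : Finite A.sha := (hGZK A (by omega)).2
  exact missingPPartAt_of_bsdp A p (bsdp_rankZero_of_S30 A p hS30 hmod hGZK hp hgo hsurj haux hr)

/-- **The partner's LOWER half from Skinner–Urban 2014 Thm. 2 (a), facts explicit** — the conclusion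
of the registered stub `stub_partnerLowerSU` of line `three_field_road` v3 with its three named inputs
displayed (bsd.S30 `hS30`, modularity `hmod`, GZK `hGZK`) instead of the conjunction `PrintedFactsR0`:
`MissingLowerBoundAt A p`, i.e. `ord_p #Ш_an(A) ≤ ord_p #Ш(A)` with `#Ш_an(A)` rational; the first half
of `missingPPartAt_rankZero_of_S30`. [cite: SkinnerUrban2014, Thm. 2 (a) (p. 3)]
[cite: Miller2011LMS, Def. 1.1] -/
theorem missingLowerBoundAt_rankZero_of_S30 (hS30 : padicValRat_bsd_rank_zero)
    (hmod : hasEntireLFunction_rat) (hGZK : rank_eq_analyticRank_of_analyticRank_le_one)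
    (A : WeierstrassCurve ℚ) [A.IsElliptic] [A.IsGloballyMinimal] (p : ℕ) [Fact p.Prime]
    (hp : 3 ≤ p) (hr : A.analyticRank = 0) (hgo : GoodOrd A p) (hsurj : Surj A p)
    (haux : ∃ ℓ : ℕ, ∃ _ : Fact ℓ.Prime, ℓ ≠ p ∧ A.HasMultiplicativeReductionAtPrime ℓ ∧
      ¬ p ∣ padicValInt ℓ A.minimalDiscriminantInt) :
    MissingLowerBoundAt A p :=
  (lower_and_upper_of_missingPPartAt A p
    (missingPPartAt_rankZero_of_S30 hS30 hmod hGZK A p hp hr hgo hsurj haux)).1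

end Summit.BirchSwinnertonDyer.BirchSwinnertonDyer.Theorems.AdditiveBranchIMCThreeFieldRoad

end
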